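/-
# [B4] THEOREM (1.10), VALUE MEMBER, ON A BOX — HYPOTHESIS-FREE FOR A (1.7)-REGULAR FIELD CONSTANT NEAR `∂Ω`
(R9 carrier bridge, file 6)

statement-level skeleton of published theorems with citation tags; proofs where landed; nothing here is a claim about
the Yang–Mills mass gap

[B4] = Balaban, *Regularity and decay of lattice Green's functions*, Commun. Math. Phys. 89 (1983) 571–597.

THEOREM p.573: «|G_k(Ω,A;x,x′)| ≤ c₀e^{−δ₀|x−x′|} (1.10) … for A satisfying (1.7) with e sufficiently small»; p.581:
«Only here we needed the assumption that A is constant in a neighbourhood of ∂□».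

`B4Thm110BoxWalk.thm110_value_box_cubeField` (file 5) reduced the value member of (1.10) on `Ω = Box d ℓ k Mb` for the
component field `A = compField Ac` and the print's cube configurations `Ã_j = A(0) + θ_j(A − A(0))`
(`B4CubeFields22.cubeField`) to the per-cube inputs `‖G_k(Ω,Ã_j)Φ‖_∞ ≤ c_G‖Φ‖_∞`, `‖K_{h_j}G_k(Ω,Ã_j)h_jΦ‖_∞ ≤ c_K‖Φ‖_∞`
and `3^{d+1}√N c_K ≤ e^{−1}`.  THIS FILE DISCHARGES THEM: §1 the box operators `H(□,A)`, `G_k(□,A)`, `K_h` depend on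
`A` only through its nearest-neighbour bond values (`opA_congr_bonds`, `greenA_congr_bonds`, `kOp_congr_bonds`); §2 if
`A = A(0)` on the collar of width `K` at `∂Ω`, then for every NON-interior label `Ã_j` is the constant configuration on
bonds (`cubeField_eq_constBond_of_collar`); §3 the inputs at a constant configuration, uniformly in the charge
(`const_inputs`: `B4Lemma22ReduceZero.const_box_sup`, `B4Eq220FactorField.eq220_hBox_sup_stair` at `A′ = 0`, p35's
`greenA_smul`/`kOp_smul`); §4 the interior inputs are p35's `B4Eq220CubeField.lemma22_sup_cubeField`/`eq220_cubeField`,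
the large-cube size is CHOSEN `K = 8(⌈3^{d+1}√N(C₂ + C₀)e⌉ + 1)` ((2.21)–(2.22) «M sufficiently large»), all fed to file 5.

MAIN THEOREM `thm110_value_box_regular`: there are `K` (`8 ≤ K`, `4 ∣ K`) and `c₀ > 0` (depending on the structure
group data, `d`, `L`, the window) such that for all `c ≥ 0`, `β > 0` and box-size bound `S` there is `e₁ > 0` with:
for every `k ≥ 1`, `(a,m²)` in the window, box `Ω` with `K ∣ Mb_μ ≤ S`, component field `A` (1.7)-regular on `Ω` with
`0 < e ≤ e₁` and constant on the collar of width `K` at `∂Ω`, fine site `x`, set `P` at sup-distance `≥ D` (unit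
lattice) from `x`, source `f` supported in `P`: `|(G_k(Ω,A)f)(x)| ≤ c₀e^{−D/K}‖f‖_∞` — (1.10), value member, `δ₀ = 1/K`.

HONEST SCOPE.  Boxes; value member; the lineage's (1.6) (running coefficient `a_kη^{d+1}`, staircase contours, charge
`eη`); `A₀ := A(0)` in `Ã_j` (p35's convention) makes `e₁` depend on the box-size bound `S` (print: uniform in `Ω`) —
recorded, not hidden; collar width `K` = the print's `M`.  No `Prop` fact, no `sorry`; axioms standard.
-/
import Literature.MathematicalPhysics.QuantumFieldTheory.Balaban1983to89.B4Thm110BoxWalk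
import Literature.MathematicalPhysics.QuantumFieldTheory.Balaban1983to89.B4Eq220CubeField

namespace Literature.MathematicalPhysics.QuantumFieldTheory.Balaban1983to89.B4Thm110BoxRegular

open Literature.MathematicalPhysics.QuantumFieldTheory.Balaban1983to89.B4Reflection242 (boxDom mem_boxDom nbrs mem_nbrs
  blk)
open Literature.MathematicalPhysics.QuantumFieldTheory.Balaban1983to89.B4GaugeCovariance
open Literature.MathematicalPhysics.QuantumFieldTheory.Balaban1983to89.B4Commutators25to211 (mulH opK)
open Literature.MathematicalPhysics.QuantumFieldTheory.Balaban1983to89.B4Lower18Regular (e1 lsum PathRel baseEmb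
  stairContour stairContour_nn stairContour_end transport_fieldLink)
open Literature.MathematicalPhysics.QuantumFieldTheory.Balaban1983to89.B4Lower18RegularRegion (compField constBond_step
  constBond_step_rev)
open Literature.MathematicalPhysics.QuantumFieldTheory.Balaban1983to89.B4Lemma22ReduceZero (Box opA greenA greenA0
  const_box_sup)
open Literature.MathematicalPhysics.QuantumFieldTheory.Balaban1983to89.B4Lemma22Reduce231 (supN supN_nonneg)
open Literature.MathematicalPhysics.QuantumFieldTheory.Balaban1983to89.B4PartitionUnity22 (hCube hprof D1 D2 D1_nonneg
  D2_nonneg contDiff_hprof hasCompactSupport_hprof)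
open Literature.MathematicalPhysics.QuantumFieldTheory.Balaban1983to89.B4Eq220PartitionSizes (hBox)
open Literature.MathematicalPhysics.QuantumFieldTheory.Balaban1983to89.B4Eq220CommutatorField (kOp)
open Literature.MathematicalPhysics.QuantumFieldTheory.Balaban1983to89.B4Eq220FactorField (eq220_hBox_sup_stair)
open Literature.MathematicalPhysics.QuantumFieldTheory.Balaban1983to89.B4CubeFields22
open Literature.MathematicalPhysics.QuantumFieldTheory.Balaban1983to89.B4CubeFieldHyps22 (aSeq_window greenA_smul
  kOp_smul constBond_smul)
open Literature.MathematicalPhysics.QuantumFieldTheory.Balaban1983to89.B4Eq220CubeField (eq220_cubeField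
  lemma22_sup_cubeField)
open Literature.MathematicalPhysics.QuantumFieldTheory.Balaban1983to89.B4BoxCubeGeometry (posR labels)
open Literature.MathematicalPhysics.QuantumFieldTheory.Balaban1983to89.B4Thm110BoxWalk (thm110_value_box_cubeField)
open scoped Matrix

noncomputable section

variable {d : ℕ}
variable {ι : Type} [Fintype ι] [DecidableEq ι]

/-! ## 1. The box operators depend on the configuration only through its bond values -/

/-- bond sums along an `r`-path of two configurations agreeing on `r`-pairs coincide. [folklore] -/
private theorem lsum_congr_rel {X : Type*} {r : X → X → Prop} {B B' : X → X → ℝ}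
    (h : ∀ u v, r u v → B u v = B' u v) :
    ∀ (x : X) (l : List X), PathRel r x l → lsum B x l = lsum B' x l
  | _, [], _ => rfl
  | x, y :: l, hp => by
      have hp' : r x y ∧ PathRel r y l := hp
      rw [lsum, lsum, h x y hp'.1, lsum_congr_rel h y l hp'.2]

omit [DecidableEq ι] in
/-- the covariant Laplacian (1.3) depends on the links only where the bond weight is non-zero. [folklore] -/
private theorem covLap_congr_wt {X : Type*} [Fintype X] [DecidableEq X] [DecidableEq ι] {c : X → X → ℝ}
    {W W' : X → X → Matrix ι ι ℝ} (h : ∀ x y, c x y ≠ 0 → W x y = W' x y) : covLap c W = covLap c W' := by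
  unfold covLap
  refine Finset.sum_congr rfl fun x _ => Finset.sum_congr rfl fun y _ => ?_
  by_cases hc : c x y = 0
  · rw [hc, zero_smul, zero_smul]
  · have hb : bondDiff W x y = bondDiff W' x y := by
      unfold bondDiff
      rw [h x y hc]
    rw [hb]

/-- **THE STAIRCASE TRANSPORTERS `U(A(Γ_{y,x}))` DEPEND ON `A` ONLY THROUGH ITS BOND VALUES** (the staircase runs along
nearest-neighbour bonds). [cite: Balaban1983RegularityDecay, (1.4) p.572 «U(A(Γ)) … A(Γ) = Σ_{b⊂Γ}A_b»] -/
theorem contourTrans_congr_bonds (F : OrthFlow ι) (κ : ℝ) {ℓ k : ℕ} {M : Fin (d + 1) → ℕ} (hn : 1 ≤ (ℓ + 1) ^ k)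
    {B B' : ↥(Box d ℓ k M) → ↥(Box d ℓ k M) → ℝ} (h : ∀ u v : ↥(Box d ℓ k M), v.1 ∈ nbrs u.1 → B u v = B' u v) :
    contourTrans (fieldLink F κ B) (baseEmb hn M) (stairContour hn M)
      = contourTrans (fieldLink F κ B') (baseEmb hn M) (stairContour hn M) := by
  funext y x
  unfold contourTrans
  rw [transport_fieldLink, transport_fieldLink, lsum_congr_rel h _ _ (stairContour_nn hn M y x)]

/-- **`H(□,A)` (1.6) DEPENDS ON `A` ONLY THROUGH ITS VALUES ON NEAREST-NEIGHBOUR BONDS** (bond weights `boxWt` vanish off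
bonds; staircase transporters). [cite: Balaban1983RegularityDecay, (1.3)–(1.6) p.572] -/
theorem opA_congr_bonds (F : OrthFlow ι) (κ : ℝ) {ℓ k : ℕ} (hn : 1 ≤ (ℓ + 1) ^ k) (a m2 : ℝ)
    (M : Fin (d + 1) → ℕ) {B B' : ↥(Box d ℓ k M) → ↥(Box d ℓ k M) → ℝ}
    (h : ∀ u v : ↥(Box d ℓ k M), v.1 ∈ nbrs u.1 → B u v = B' u v) :
    opA d F κ ℓ k a m2 M (baseEmb hn M) (stairContour hn M) B
      = opA d F κ ℓ k a m2 M (baseEmb hn M) (stairContour hn M) B' := by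
  have hT := contourTrans_congr_bonds F κ hn h
  have hL : covLap (boxWt ((ℓ + 1) ^ k) (fun i => (ℓ + 1) ^ k * M i)) (fieldLink F κ B)
      = covLap (boxWt ((ℓ + 1) ^ k) (fun i => (ℓ + 1) ^ k * M i)) (fieldLink F κ B') :=
    covLap_congr_wt fun x y hc => by
      have hxy : y.1 ∈ nbrs x.1 := by
        by_contra hc'
        apply hc
        unfold boxWt
        rw [if_neg hc', mul_zero]
      show F.U (κ * B x y) = F.U (κ * B' x y)
      rw [h x y hxy]
  unfold opA b4Op covOp
  rw [hL, hT]

/-- **`G_k(□,A)` DEPENDS ON `A` ONLY THROUGH ITS BOND VALUES.** [cite: Balaban1983RegularityDecay, (1.6) p.572] -/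
theorem greenA_congr_bonds (F : OrthFlow ι) (κ : ℝ) {ℓ k : ℕ} (hn : 1 ≤ (ℓ + 1) ^ k) (a m2 : ℝ)
    (M : Fin (d + 1) → ℕ) {B B' : ↥(Box d ℓ k M) → ↥(Box d ℓ k M) → ℝ}
    (h : ∀ u v : ↥(Box d ℓ k M), v.1 ∈ nbrs u.1 → B u v = B' u v) :
    greenA d F κ ℓ k a m2 M (baseEmb hn M) (stairContour hn M) B
      = greenA d F κ ℓ k a m2 M (baseEmb hn M) (stairContour hn M) B' := by
  show (opA d F κ ℓ k a m2 M (baseEmb hn M) (stairContour hn M) B)⁻¹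
      = (opA d F κ ℓ k a m2 M (baseEmb hn M) (stairContour hn M) B')⁻¹
  rw [opA_congr_bonds F κ hn a m2 M h]

/-- **`K_h = [h, H(□,A)]` (2.10) DEPENDS ON `A` ONLY THROUGH ITS BOND VALUES.** [cite: Balaban1983RegularityDecay, (2.10) p.576] -/
theorem kOp_congr_bonds (F : OrthFlow ι) (κ : ℝ) {ℓ k : ℕ} (hn : 1 ≤ (ℓ + 1) ^ k) (a m2 : ℝ)
    (M : Fin (d + 1) → ℕ) {B B' : ↥(Box d ℓ k M) → ↥(Box d ℓ k M) → ℝ}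
    (h : ∀ u v : ↥(Box d ℓ k M), v.1 ∈ nbrs u.1 → B u v = B' u v) (hh : ↥(Box d ℓ k M) → ℝ) :
    kOp F κ ((ℓ + 1) ^ k) (B1.aSeq a ((ℓ : ℝ) + 1) k) m2 M (baseEmb hn M) (stairContour hn M) B hh
      = kOp F κ ((ℓ + 1) ^ k) (B1.aSeq a ((ℓ : ℝ) + 1) k) m2 M (baseEmb hn M) (stairContour hn M) B' hh := by
  show mulH (ι := ι) hh * opA d F κ ℓ k a m2 M (baseEmb hn M) (stairContour hn M) B
        - opA d F κ ℓ k a m2 M (baseEmb hn M) (stairContour hn M) B * mulH (ι := ι) hh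
      = mulH (ι := ι) hh * opA d F κ ℓ k a m2 M (baseEmb hn M) (stairContour hn M) B'
        - opA d F κ ℓ k a m2 M (baseEmb hn M) (stairContour hn M) B' * mulH (ι := ι) hh
  rw [opA_congr_bonds F κ hn a m2 M h]

/-! ## 2. Near `∂Ω` the cube configuration of a field constant on the collar is the constant configuration -/

omit [Fintype ι] [DecidableEq ι] in
/-- a fine site where `θ_j ≠ 0`, for a label `j` that is NOT interior (`j_μ ≤ 0` or `Kj_μ ≥ Mb_μ` for some `μ`), lies in
the collar of width `K` (unit lattice) at `∂Ω` — the support of `θ_j` is the open 7/8-box (`B4CubeFields22.thetaZ_eq_zero`).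
[cite: Balaban1983RegularityDecay, §2 p.575 «θ_j ∈ C₀^∞({x: |x − Mj| < ⅞M})»] -/
theorem collar_of_thetaZ_ne_zero {ℓ k : ℕ} {Mb : Fin (d + 1) → ℕ} {K : ℕ} (hn : 1 ≤ (ℓ + 1) ^ k) (hK : 1 ≤ K)
    {j : Fin (d + 1) → ℤ} (hj : ∃ μ, j μ ≤ 0 ∨ (Mb μ : ℤ) ≤ (K : ℤ) * j μ) {w : Fin (d + 1) → ℤ}
    (hw : thetaZ ((ℓ + 1) ^ k) K j w ≠ 0) :
    ∃ μ, w μ < (((ℓ + 1) ^ k : ℕ) : ℤ) * K ∨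
      (((ℓ + 1) ^ k : ℕ) : ℤ) * Mb μ < w μ + (((ℓ + 1) ^ k : ℕ) : ℤ) * K := by
  obtain ⟨μ, hμ⟩ := hj
  refine ⟨μ, ?_⟩
  have hnr : (0 : ℝ) < (((ℓ + 1) ^ k : ℕ) : ℝ) := by exact_mod_cast hn
  have hKr : (0 : ℝ) < K := by exact_mod_cast hK
  have hlt : 8 * |((w μ : ℤ) : ℝ) - ((((ℓ + 1) ^ k : ℕ)) : ℝ) * K * j μ| < 7 * (((((ℓ + 1) ^ k : ℕ)) : ℝ) * K) := by
    by_contra hc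
    exact hw (thetaZ_eq_zero hn hK (not_lt.mp hc))
  obtain ⟨h1, h2⟩ := abs_lt.1 (show |((w μ : ℤ) : ℝ) - ((((ℓ + 1) ^ k : ℕ)) : ℝ) * K * j μ|
    < 7 / 8 * (((((ℓ + 1) ^ k : ℕ)) : ℝ) * K) by linarith)
  rcases hμ with hμ | hμ
  · left
    have hjr : (j μ : ℝ) ≤ 0 := by exact_mod_cast hμ
    have : ((w μ : ℤ) : ℝ) < (((ℓ + 1) ^ k : ℕ) : ℝ) * K := by nlinarith [mul_pos hnr hKr]
    exact_mod_cast this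
  · right
    have hjr : ((Mb μ : ℤ) : ℝ) ≤ (K : ℝ) * j μ := by exact_mod_cast hμ
    have : (((ℓ + 1) ^ k : ℕ) : ℝ) * ((Mb μ : ℤ) : ℝ) < ((w μ : ℤ) : ℝ) + (((ℓ + 1) ^ k : ℕ) : ℝ) * K := by
      nlinarith [mul_pos hnr hKr]
    have : (((ℓ + 1) ^ k : ℕ) : ℤ) * (Mb μ : ℤ) < w μ + (((ℓ + 1) ^ k : ℕ) : ℤ) * K := by exact_mod_cast this
    exact this

omit [Fintype ι] [DecidableEq ι] in
/-- **«ONLY HERE WE NEEDED THE ASSUMPTION THAT A IS CONSTANT IN A NEIGHBOURHOOD OF ∂□»** (p.581): if the component field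
is constant (`= A(0)`) on the collar of width `K` at `∂Ω`, then for every non-interior label `j` the cube configuration
`Ã_j = A(0) + θ_j(A − A(0))` coincides with the constant configuration `A(0)` ON EVERY NEAREST-NEIGHBOUR BOND of `Ω`.
[cite: Balaban1983RegularityDecay, p.581; §2 p.575 (Ã_j)] -/
theorem cubeField_eq_constBond_of_collar {ℓ k : ℕ} {Mb : Fin (d + 1) → ℕ} {K : ℕ} (hn : 1 ≤ (ℓ + 1) ^ k)
    (hK : 1 ≤ K) (Ac : (Fin (d + 1) → ℤ) → Fin (d + 1) → ℝ) {j : Fin (d + 1) → ℤ}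
    (hj : ∃ μ, j μ ≤ 0 ∨ (Mb μ : ℤ) ≤ (K : ℤ) * j μ)
    (hcol : ∀ w : ↥(Box d ℓ k Mb), (∃ μ, w.1 μ < (((ℓ + 1) ^ k : ℕ) : ℤ) * K ∨
      (((ℓ + 1) ^ k : ℕ) : ℤ) * Mb μ < w.1 μ + (((ℓ + 1) ^ k : ℕ) : ℤ) * K) → ∀ ν, Ac w.1 ν = Ac 0 ν)
    (u v : ↥(Box d ℓ k Mb)) (huv : v.1 ∈ nbrs u.1) :
    cubeField (Box d ℓ k Mb) ((ℓ + 1) ^ k) K j (Ac 0) Ac u v = constBond (Ac 0) Subtype.val u v := by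
  -- the key fact: `θ_j(w)(A_ν(w) − A_ν(0)) = 0` for every fine site `w` of `Ω`
  have key : ∀ (w : ↥(Box d ℓ k Mb)) (ν : Fin (d + 1)),
      thetaZ ((ℓ + 1) ^ k) K j w.1 * (Ac w.1 ν - Ac 0 ν) = 0 := by
    intro w ν
    by_cases hθ : thetaZ ((ℓ + 1) ^ k) K j w.1 = 0
    · rw [hθ, zero_mul]
    · rw [hcol w (collar_of_thetaZ_ne_zero hn hK hj hθ) ν, sub_self, mul_zero]
  obtain ⟨i, hi⟩ := mem_nbrs.1 huv
  rcases hi with hi | hi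
  · have hv : v.1 = u.1 + e1 i := hi
    rw [cubeField_step _ _ _ _ _ hv, constBond_step _ hv, key u i, add_zero]
  · have hu : u.1 = v.1 + e1 i := by rw [hi]; exact (sub_add_cancel _ _).symm
    rw [cubeField_antisymm _ _ _ _ _ v u, cubeField_step _ _ _ _ _ hu, constBond_step_rev _ hu, key v i, add_zero]

/-! ## 3. The inputs at a constant configuration, uniformly in the charge -/

/-- **LEMMA 2.2 AND (2.20) AT A CONSTANT CONFIGURATION `A₀`, EVERY CHARGE, EVERY LABEL** (boxes with sides multiples of
`K ≥ 2`): `‖G_k(□,A₀)Φ‖_∞ ≤ c_G‖Φ‖_∞` («Lemma 2.2 holds for G_k(□,A₀) with constant configurations A₀», the gauge step,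
`B4Lemma22ReduceZero.const_box_sup`) and `‖K_{h_j}G_k(□,A₀)h_jΦ‖_∞ ≤ (c_K/K)‖Φ‖_∞` ((2.20) «c₂O(1)M⁻¹»,
`B4Eq220FactorField.eq220_hBox_sup_stair` at `A′ = 0`); charge uniformity by `κA₀ = (κA₀)`.
[cite: Balaban1983RegularityDecay, p.581; (2.20) p.578] -/
theorem const_inputs (F : OrthFlow ι) {ℓ₁ : ℝ} (hℓ₁ : 0 ≤ ℓ₁)
    (hLip : ∀ t (v : ι → ℝ), ((F.U t - 1) *ᵥ v) ⬝ᵥ ((F.U t - 1) *ᵥ v) ≤ (ℓ₁ * t) ^ 2 * (v ⬝ᵥ v))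
    (d ℓ : ℕ) (hℓ : 1 ≤ ℓ) (amin aplus m2plus : ℝ) (ha : 0 < amin) :
    ∃ cG₀ cK₀ : ℝ, 0 < cG₀ ∧ 0 < cK₀ ∧ ∀ (k : ℕ), 1 ≤ k → ∀ (hn : 1 ≤ (ℓ + 1) ^ k) (a m2 : ℝ),
      amin ≤ a → a ≤ aplus → 0 ≤ m2 → m2 ≤ m2plus → ∀ (M : Fin (d + 1) → ℕ), (∀ i, 1 ≤ M i) →
      ∀ (K : ℕ) (j : Fin (d + 1) → ℤ), 2 ≤ K → (∀ μ, K ∣ M μ) → ∀ (κ : ℝ) (A₀ : Fin (d + 1) → ℝ),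
        (∀ Φ : ↥(Box d ℓ k M) × ι → ℝ,
          supN (greenA d F κ ℓ k a m2 M (baseEmb hn M) (stairContour hn M) (constBond A₀ Subtype.val) *ᵥ Φ)
            ≤ cG₀ * supN Φ) ∧
        (∀ Φ : ↥(Box d ℓ k M) × ι → ℝ,
          supN (kOp F κ ((ℓ + 1) ^ k) (B1.aSeq a ((ℓ : ℝ) + 1) k) m2 M (baseEmb hn M) (stairContour hn M)
                (constBond A₀ Subtype.val) (hBox ((ℓ + 1) ^ k) K M j)
              *ᵥ (greenA d F κ ℓ k a m2 M (baseEmb hn M) (stairContour hn M) (constBond A₀ Subtype.val)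
                *ᵥ (mulH (ι := ι) (hBox ((ℓ + 1) ^ k) K M j) *ᵥ Φ)))
            ≤ cK₀ / K * supN Φ) := by
  obtain ⟨c₁, hc₁, h₁⟩ := const_box_sup F 1 d ℓ hℓ amin aplus m2plus ha
  obtain ⟨c₂, hc₂, h₂⟩ := eq220_hBox_sup_stair F hℓ₁ hLip 1 d ℓ hℓ amin aplus m2plus ha
  have hs : 0 ≤ ((d : ℝ) + 1) * (D1 hprof + D2 hprof) := by
    have := D1_nonneg contDiff_hprof hasCompactSupport_hprof
    have := D2_nonneg contDiff_hprof hasCompactSupport_hprof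
    positivity
  refine ⟨c₁, (2 * ((d : ℝ) + 1) + 1 + |aplus|) * (((d : ℝ) + 1) * (D1 hprof + D2 hprof))
    * (2 * (((d : ℝ) + 2) * c₂)) + 1, hc₁, by positivity, ?_⟩
  intro k hk hn a m2 e1' e2 e3 e4 M hM K j hK2 hKM κ A₀
  have hκ : (fun u v : ↥(Box d ℓ k M) => κ * constBond A₀ Subtype.val u v)
      = constBond (fun μ => κ * A₀ μ) Subtype.val := by
    funext u v
    exact constBond_smul κ A₀ _ u v
  constructor
  · intro Φ
    rw [greenA_smul, hκ]
    exact (h₁ k hk a m2 e1' e2 e3 e4 M hM (baseEmb hn M) (stairContour hn M) (stairContour_end hn M)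
      (fun μ => κ * A₀ μ)).1 Φ
  · intro Φ
    rw [kOp_smul, greenA_smul, hκ]
    obtain ⟨hak1, hak2⟩ := aSeq_window hℓ hk ha e1' e2
    have hak0 : 0 ≤ B1.aSeq a ((ℓ : ℝ) + 1) k := by linarith
    have hsm2 : ℓ₁ ^ 2 * (0 : ℝ) ^ 2 * ((d : ℝ) + 1) * (1 + B1.aSeq a ((ℓ : ℝ) + 1) k * ((d : ℝ) + 1))
        ≤ min 2 (B1.aSeq a ((ℓ : ℝ) + 1) k) / 4 := by
      rw [show ℓ₁ ^ 2 * (0 : ℝ) ^ 2 * ((d : ℝ) + 1) * (1 + B1.aSeq a ((ℓ : ℝ) + 1) k * ((d : ℝ) + 1)) = 0 by ring]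
      exact div_nonneg (le_min zero_le_two hak0) (by norm_num)
    have hsm : ((d : ℝ) + 2) * c₂ * (((d : ℝ) + 1) * ℓ₁ * (0 + 0) + ((d : ℝ) + 1) * ℓ₁ * 0
        + ((d : ℝ) + 1) * ℓ₁ ^ 2 * 0 ^ 2
        + B1.aSeq a ((ℓ : ℝ) + 1) k * (ℓ₁ * (((d : ℝ) + 1) * 0) * (2 + ℓ₁ * (((d : ℝ) + 1) * 0)))) ≤ 1 / 2 := by
      norm_num
    have main := h₂ k hk hn a m2 e1' e2 e3 e4 M hM K j hK2 hKM (fun μ => κ * A₀ μ) 0 0 0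
      (fun x y => by simp) le_rfl (fun x y _ => by simp) le_rfl (fun x z y μ _ _ => by simp)
      (fun x y μ _ _ => by simp) hsm2 hsm Φ
    rw [add_zero] at main
    refine main.trans (mul_le_mul_of_nonneg_right ?_ (supN_nonneg Φ))
    have hK0 : (0 : ℝ) < K := by exact_mod_cast lt_of_lt_of_le (by norm_num) hK2
    rw [mul_zero, add_zero, mul_one,
      show (2 * ((d : ℝ) + 1) + 1 + B1.aSeq a ((ℓ : ℝ) + 1) k) * (((d : ℝ) + 1) * (D1 hprof + D2 hprof)) / K
          * (2 * (((d : ℝ) + 2) * c₂))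
        = ((2 * ((d : ℝ) + 1) + 1 + B1.aSeq a ((ℓ : ℝ) + 1) k) * (((d : ℝ) + 1) * (D1 hprof + D2 hprof))
          * (2 * (((d : ℝ) + 2) * c₂))) / K by ring]
    refine div_le_div_of_nonneg_right ?_ hK0.le
    have hc2 : 0 ≤ 2 * (((d : ℝ) + 2) * c₂) := by positivity
    have h1 : 2 * ((d : ℝ) + 1) + 1 + B1.aSeq a ((ℓ : ℝ) + 1) k ≤ 2 * ((d : ℝ) + 1) + 1 + |aplus| := by
      linarith [le_abs_self aplus]
    have h3 := mul_le_mul_of_nonneg_right (mul_le_mul_of_nonneg_right h1 hs) hc2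
    linarith

/-! ## 4. THEOREM (1.10), value member, on a box — hypothesis-free for a regular field constant near `∂Ω` -/

omit [Fintype ι] [DecidableEq ι] in
/-- a label of `labels Mb` that is not interior in p35's sense is a boundary/outer label in the sense of §2 (box sides
multiples of `K`). [cite: Balaban1983RegularityDecay, §2 p.575, dictionary] -/
private theorem nonint {K : ℕ} {Mb : Fin (d + 1) → ℕ} {j : Fin (d + 1) → ℤ} (hKM : ∀ μ, K ∣ Mb μ)
    (h : ¬ ∀ μ, 1 ≤ j μ ∧ (K : ℤ) * (j μ + 1) ≤ (Mb μ : ℤ)) : ∃ μ, j μ ≤ 0 ∨ (Mb μ : ℤ) ≤ (K : ℤ) * j μ := by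
  obtain ⟨μ, hμ⟩ := not_forall.mp h
  refine ⟨μ, ?_⟩
  by_cases h1 : 1 ≤ j μ
  · right
    have h2 : ¬ (K : ℤ) * (j μ + 1) ≤ (Mb μ : ℤ) := fun h2 => hμ ⟨h1, h2⟩
    obtain ⟨t, ht⟩ := hKM μ
    have ht' : (Mb μ : ℤ) = (K : ℤ) * t := by exact_mod_cast ht
    rw [ht'] at h2 ⊢
    have hK0 : (0 : ℤ) ≤ K := Nat.cast_nonneg K
    have : (t : ℤ) < j μ + 1 := Int.lt_of_mul_lt_mul_left (not_le.mp h2) hK0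
    exact mul_le_mul_of_nonneg_left (by omega) hK0
  · left
    omega

/-- **THEOREM (1.10) OF [B4] ON A BOX, VALUE MEMBER — FOR A (1.7)-REGULAR FIELD CONSTANT NEAR `∂Ω`, WITH «e SUFFICIENTLY
SMALL» AND THE LARGE-CUBE SIZE CHOSEN** (pp.573–579, p.581): there are `K` (`8 ≤ K`, `4 ∣ K`) and `c₀ > 0` (depending on
the structure group data, `d`, `L`, the window) such that for all `c ≥ 0`, `β > 0`, `S` there is `e₁ > 0` with — for every
`k ≥ 1`, `(a,m²) ∈ [a₋,a₊]×[0,m²₊]`, box `Ω = Π[0, nMb_μ)` with `K ∣ Mb_μ`, `1 ≤ Mb_μ ≤ S`, component field `A` with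
`|A_ν(x+e_μ) − A_ν(x)| ≤ c·e^{β−1}η` on `Ω` ((1.7)), `0 < e ≤ e₁`, `A = A(0)` on the collar of width `K` at `∂Ω`, every
fine site `x`, every set `P` with `|x/n − x′/n|_∞ ≥ D` on `P`, every source `f` supported in `P` with `|f| ≤ φ` —
`|(G_k(Ω,A)f)(x)| ≤ c₀·e^{−D/K}·φ`. [cite: Balaban1983RegularityDecay, Theorem (1.10) p.573; pp.575–579, p.581] -/
theorem thm110_value_box_regular (F : OrthFlow ι) {ℓ₁ : ℝ} (hℓ₁ : 0 ≤ ℓ₁)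
    (hLip : ∀ t (v : ι → ℝ), ((F.U t - 1) *ᵥ v) ⬝ᵥ ((F.U t - 1) *ᵥ v) ≤ (ℓ₁ * t) ^ 2 * (v ⬝ᵥ v))
    (d ℓ : ℕ) (hℓ : 1 ≤ ℓ) (amin aplus m2plus : ℝ) (ha : 0 < amin) :
    ∃ K : ℕ, 8 ≤ K ∧ 4 ∣ K ∧ ∃ c₀ : ℝ, 0 < c₀ ∧ ∀ (creg β : ℝ), 0 ≤ creg → 0 < β → ∀ (S : ℕ),
      ∃ e₁ : ℝ, 0 < e₁ ∧ ∀ (k : ℕ), 1 ≤ k → ∀ (hn : 1 ≤ (ℓ + 1) ^ k) (a m2 : ℝ),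
      amin ≤ a → a ≤ aplus → 0 ≤ m2 → m2 ≤ m2plus →
      ∀ (Mb : Fin (d + 1) → ℕ), (∀ i, 1 ≤ Mb i) → (∀ i, Mb i ≤ S) → (∀ μ, K ∣ Mb μ) →
      ∀ (Ac : (Fin (d + 1) → ℤ) → Fin (d + 1) → ℝ) (e : ℝ), 0 < e → e ≤ e₁ →
        (∀ x ∈ Box d ℓ k Mb, ∀ μ ν : Fin (d + 1),
          |Ac (x + e1 μ) ν - Ac x ν| ≤ creg * e ^ (β - 1) / ((ℓ + 1) ^ k : ℕ)) →
        (∀ w ∈ Box d ℓ k Mb, (∃ μ, w μ < (((ℓ + 1) ^ k : ℕ) : ℤ) * K ∨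
            (((ℓ + 1) ^ k : ℕ) : ℤ) * Mb μ < w μ + (((ℓ + 1) ^ k : ℕ) : ℤ) * K) → ∀ ν, Ac w ν = Ac 0 ν) →
      ∀ (x : ↥(Box d ℓ k Mb)) (P : ↥(Box d ℓ k Mb) → Prop) [DecidablePred P] (D : ℝ),
        (∀ x', P x' → ∃ μ, D ≤ |posR ℓ k Mb x μ - posR ℓ k Mb x' μ|) →
      ∀ (f : ↥(Box d ℓ k Mb) × ι → ℝ), (∀ p, ¬ P p.1 → f p = 0) → ∀ (φ : ℝ), 0 ≤ φ → (∀ p, |f p| ≤ φ) →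
      ∀ i : ι,
        |(greenA d F (e / ((ℓ + 1) ^ k : ℕ)) ℓ k a m2 Mb (baseEmb hn Mb) (stairContour hn Mb)
            (fun u v : ↥(Box d ℓ k Mb) => compField Ac u.1 v.1) *ᵥ f) (x, i)|
          ≤ c₀ * Real.exp (-(D / K)) * φ := by
  obtain ⟨C₁, hC₁, h₁⟩ := lemma22_sup_cubeField F hℓ₁ hLip d ℓ hℓ amin aplus m2plus ha
  obtain ⟨C₂, hC₂, h₂⟩ := eq220_cubeField F hℓ₁ hLip d ℓ hℓ amin aplus m2plus ha
  obtain ⟨cG₀, cK₀, hcG₀, hcK₀, h₀⟩ := const_inputs F hℓ₁ hLip d ℓ hℓ amin aplus m2plus ha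
  set X : ℝ := (3 : ℝ) ^ (d + 1) * Real.sqrt (Fintype.card ι) * (C₂ + cK₀) * Real.exp 1 with hX
  have hX0 : 0 ≤ X := by positivity
  set K : ℕ := 8 * (⌈X⌉₊ + 1) with hK
  have hK8 : 8 ≤ K := by omega
  have h4 : 4 ∣ K := ⟨2 * (⌈X⌉₊ + 1), by omega⟩
  have hK2 : 2 ≤ K := by omega
  have hK1 : 1 ≤ K := by omega
  have hKr : (0 : ℝ) < K := by exact_mod_cast hK1
  have hKX : X ≤ K := by
    refine (Nat.le_ceil X).trans ?_
    rw [hK]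
    push_cast
    linarith [(Nat.cast_nonneg ⌈X⌉₊ : (0 : ℝ) ≤ ⌈X⌉₊)]
  set cG : ℝ := max C₁ cG₀ with hcG_def
  set cK : ℝ := (C₂ + cK₀) / K with hcK_def
  have hcG : 0 ≤ cG := hC₁.le.trans (le_max_left _ _)
  have hcK : 0 ≤ cK := div_nonneg (by positivity) hKr.le
  have h3 : (3 : ℝ) ^ (d + 1) * (Real.sqrt (Fintype.card ι) * cK) ≤ Real.exp (-1) := by
    have hexp : Real.exp 1 * Real.exp (-1) = 1 := by rw [← Real.exp_add]; norm_num
    have e : (3 : ℝ) ^ (d + 1) * (Real.sqrt (Fintype.card ι) * cK) = X / K * Real.exp (-1) := by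
      rw [hcK_def, hX]
      calc (3 : ℝ) ^ (d + 1) * (Real.sqrt (Fintype.card ι) * ((C₂ + cK₀) / K))
          = (3 : ℝ) ^ (d + 1) * Real.sqrt (Fintype.card ι) * (C₂ + cK₀) / K * (Real.exp 1 * Real.exp (-1)) := by
            rw [hexp]; ring
        _ = (3 : ℝ) ^ (d + 1) * Real.sqrt (Fintype.card ι) * (C₂ + cK₀) * Real.exp 1 / K * Real.exp (-1) := by
            ring
    rw [e]
    have : X / K ≤ 1 := div_le_one_of_le₀ hKX (Nat.cast_nonneg K)
    calc X / K * Real.exp (-1) ≤ 1 * Real.exp (-1) := mul_le_mul_of_nonneg_right this (Real.exp_pos _).le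
      _ = Real.exp (-1) := one_mul _
  set c₀ : ℝ := 2 ^ (d + 2) * Real.exp (9 / 4) * (Real.sqrt (Fintype.card ι) * cG) + 1 with hc₀
  refine ⟨K, hK8, h4, c₀, by positivity, fun creg β hcreg hβ S => ?_⟩
  obtain ⟨e₁, he₁, h₁'⟩ := h₁ creg β hcreg hβ S K hK1
  obtain ⟨e₂, he₂, h₂'⟩ := h₂ creg β hcreg hβ S K hK2
  refine ⟨min e₁ e₂, lt_min he₁ he₂, ?_⟩
  intro k hk hn a m2 ea1 ea2 em1 em2 Mb hM hS hKM Ac e he hle h17 hcol x P _ D hD f hfP φ hφ hf i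
  have hn2 : 2 ≤ (ℓ + 1) ^ k := by
    calc 2 ≤ ℓ + 1 := by omega
      _ = (ℓ + 1) ^ 1 := (pow_one _).symm
      _ ≤ (ℓ + 1) ^ k := Nat.pow_le_pow_right (Nat.succ_pos ℓ) hk
  have hnK : 16 ≤ (ℓ + 1) ^ k * K := by nlinarith
  have ha' : 0 < a := lt_of_lt_of_le ha ea1
  have hcol' : ∀ w : ↥(Box d ℓ k Mb), (∃ μ, w.1 μ < (((ℓ + 1) ^ k : ℕ) : ℤ) * K ∨
      (((ℓ + 1) ^ k : ℕ) : ℤ) * Mb μ < w.1 μ + (((ℓ + 1) ^ k : ℕ) : ℤ) * K) → ∀ ν, Ac w.1 ν = Ac 0 ν :=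
    fun w hw => hcol w.1 w.2 hw
  -- the per-cube inputs of file 5
  have hG : ∀ j ∈ labels Mb, ∀ Φ : ↥(Box d ℓ k Mb) × ι → ℝ,
      supN (greenA d F (e / ((ℓ + 1) ^ k : ℕ)) ℓ k a m2 Mb (baseEmb hn Mb) (stairContour hn Mb)
          (cubeField (Box d ℓ k Mb) ((ℓ + 1) ^ k) K j (Ac 0) Ac) *ᵥ Φ) ≤ cG * supN Φ := by
    intro j _ Φ
    by_cases hint : ∀ μ, 1 ≤ j μ ∧ (K : ℤ) * (j μ + 1) ≤ (Mb μ : ℤ)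
    · have hb := (h₁' k hk hn hnK a m2 ea1 ea2 em1 em2 Mb hM hS j (fun μ => (hint μ).1) (fun μ => (hint μ).2)
        Ac e he (hle.trans (min_le_left _ _)) h17 Φ).1
      exact hb.trans (mul_le_mul_of_nonneg_right (le_max_left _ _) (supN_nonneg Φ))
    · rw [greenA_congr_bonds F _ hn a m2 Mb (cubeField_eq_constBond_of_collar hn hK1 Ac (nonint hKM hint) hcol')]
      exact ((h₀ k hk hn a m2 ea1 ea2 em1 em2 Mb hM K j hK2 hKM _ (Ac 0)).1 Φ).trans
        (mul_le_mul_of_nonneg_right (le_max_right _ _) (supN_nonneg Φ))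
  have hKG : ∀ j ∈ labels Mb, ∀ Φ : ↥(Box d ℓ k Mb) × ι → ℝ,
      supN (kOp F (e / ((ℓ + 1) ^ k : ℕ)) ((ℓ + 1) ^ k) (B1.aSeq a ((ℓ : ℝ) + 1) k) m2 Mb (baseEmb hn Mb)
            (stairContour hn Mb) (cubeField (Box d ℓ k Mb) ((ℓ + 1) ^ k) K j (Ac 0) Ac) (hBox ((ℓ + 1) ^ k) K Mb j)
          *ᵥ (greenA d F (e / ((ℓ + 1) ^ k : ℕ)) ℓ k a m2 Mb (baseEmb hn Mb) (stairContour hn Mb)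
              (cubeField (Box d ℓ k Mb) ((ℓ + 1) ^ k) K j (Ac 0) Ac)
            *ᵥ (mulH (ι := ι) (hBox ((ℓ + 1) ^ k) K Mb j) *ᵥ Φ))) ≤ cK * supN Φ := by
    intro j _ Φ
    have hsplit : ∀ t : ℝ, 0 ≤ t → t ≤ C₂ + cK₀ → t / K * supN Φ ≤ cK * supN Φ := fun t _ ht =>
      mul_le_mul_of_nonneg_right (div_le_div_of_nonneg_right ht hKr.le) (supN_nonneg Φ)
    by_cases hint : ∀ μ, 1 ≤ j μ ∧ (K : ℤ) * (j μ + 1) ≤ (Mb μ : ℤ)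
    · have hb := h₂' k hk hn hnK a m2 ea1 ea2 em1 em2 Mb hM hS hKM j (fun μ => (hint μ).1)
        (fun μ => (hint μ).2) Ac e he (hle.trans (min_le_right _ _)) h17 Φ
      exact hb.trans (hsplit C₂ hC₂.le (by linarith))
    · have hb := cubeField_eq_constBond_of_collar hn hK1 Ac (nonint hKM hint) hcol'
      rw [kOp_congr_bonds F _ hn a m2 Mb hb, greenA_congr_bonds F _ hn a m2 Mb hb]
      exact ((h₀ k hk hn a m2 ea1 ea2 em1 em2 Mb hM K j hK2 hKM _ (Ac 0)).2 Φ).trans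
        (hsplit cK₀ hcK₀.le (by linarith))
  have main := thm110_value_box_cubeField F hℓ hk hn Mb hK8 h4 ha' em1 e Ac hcG hcK hG hKG h3 x P hD f hfP hφ hf i
  refine main.trans (mul_le_mul_of_nonneg_right (mul_le_mul_of_nonneg_right ?_ (Real.exp_pos _).le) hφ)
  rw [hc₀]
  linarith

end

end Literature.MathematicalPhysics.QuantumFieldTheory.Balaban1983to89.B4Thm110BoxRegular
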